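import Mathlib
import HarnessLib
import Summits.NavierStokesRegularity.NavierStokesRegularity.Theorems.TaylorModelRungThreeReadoutFlowV
import Summits.NavierStokesRegularity.NavierStokesRegularity.Theorems.TaylorModelRungThreeSoundnessVectorHigh

/-!
# Line `taylor-model` on crux K1b-DR (stmt-NavierStokesRegularity-23954) — (E) flow-side consumer of the vector
# step, part 1b: (F1′)/(F5′) from the HIGH-ORDER rough-enclosure test (E2)

Twin of `…ReadoutFlowV`'s (F1′)/(F5′) block for the strict order-`p` test of VECTOR-LEMMAS part 5
(`flowSel_of_highOrderEnclosure`, p615122), so that the v3 chain predicate may certify EITHER test per sub-step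
(`ChainVCore`'s (E) clause is a disjunction): `flowSel_window_of_hoTest` (window form: the selector solves on `[0,h]`,
stays in the box, obeys the componentwise remainder), `solvesOn_liftFlowSel_of_hoTest`, `window_bounds_liftFlowSel_of_hoTest`,
`taylor_liftFlowSel_of_hoTest` (cascade forms).

MODEL-lattice rung TL-M3 only; nothing here is a statement about the Navier–Stokes equations.
-/

noncomputable section

-- the sub-problem namespace repeats the summit name by design (D-0017)
set_option linter.dupNamespace false

namespace Summit.NavierStokesRegularity.NavierStokesRegularity.Theorems.TaylorModelReadout

open Set Finset
open Literature.Analysis.FluidPDE.TaoCascade Literature.Analysis.FluidPDE.TaoCascade.TaylorChain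
open Summit.NavierStokesRegularity.NavierStokesRegularity.Theorems.TaylorModelMajorant
open Summit.NavierStokesRegularity.NavierStokesRegularity.Theorems.TaylorModelVector

variable {cd : CertData} {j : ℕ} {lo hi x J : Fin 4 → ℤ → ℝ} {h : ℝ} {p : ℕ}

/-- **Window form**: under the strict order-`p` test at `x` with the jet enclosure `J` over the box, the selector from
`toVec x` solves on `[0,h]`, stays in the box, and obeys the componentwise remainder. [folklore] -/
theorem flowSel_window_of_hoTest
    (hMS : IsMajorantSystem (nW cd) (Qw cd) (wW cd j) (cd.bb j) (taylorJet (Qw cd)) (varJet (Qw cd)))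
    (hh : 0 ≤ h)
    (hJ : ∀ y : Fin 4 → ℤ → ℝ, (∀ i k, -cd.Kb ≤ k → k ≤ cd.Ka → lo i k ≤ y i k ∧ y i k ≤ hi i k) →
      ∀ i k, -cd.Kb ≤ k → k ≤ cd.Ka → |taylorJet cd.Qb y (p + 1) i k| ≤ J i k)
    (htest : ∀ u ∈ Icc (0:ℝ) h, ∀ i k, -cd.Kb ≤ k → k ≤ cd.Ka →
      lo i k < (∑ n ∈ Finset.range (p + 1), taylorJet cd.Qb x n i k * u ^ n) - J i k * u ^ (p + 1) ∧
      (∑ n ∈ Finset.range (p + 1), taylorJet cd.Qb x n i k * u ^ n) + J i k * u ^ (p + 1) < hi i k) :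
    IsSolOn (Qw cd) (toVec cd x) h (fun s => flowSel (Qw cd) (toVec cd x) s) ∧
      (∀ s ∈ Icc 0 h, flowSel (Qw cd) (toVec cd x) s ∈ Icc (toVec cd lo) (toVec cd hi)) ∧
      ∀ s ∈ Icc 0 h, ∀ c, |flowSel (Qw cd) (toVec cd x) s c -
        ∑ n ∈ Finset.range (p + 1), taylorJet (Qw cd) (toVec cd x) n c * s ^ n| ≤ toVec cd J c * s ^ (p + 1) := by
  have hJ' : ∀ yv ∈ Icc (toVec cd lo) (toVec cd hi), ∀ c', |taylorJet (Qw cd) yv (p + 1) c'| ≤ toVec cd J c' := by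
    intro yv hyv c'
    have h1 := hJ (ofVec cd yv) (ofVec_window_bounds (cd := cd) hyv) (modeOf cd c') (shellOf cd c')
      (shellOf_mem cd c').1 (shellOf_mem cd c').2
    have h2 := congrFun (toVec_taylorJet (cd := cd) (ofVec cd yv) (p + 1)) c'
    rw [toVec_ofVec] at h2
    simp only [toVec] at h2 ⊢
    rw [← h2]
    exact h1
  have htest' : ∀ u ∈ Icc (0:ℝ) h, ∀ c',
      toVec cd lo c' < ∑ n ∈ Finset.range (p + 1), taylorJet (Qw cd) (toVec cd x) n c' * u ^ n - toVec cd J c' * u ^ (p + 1) ∧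
      ∑ n ∈ Finset.range (p + 1), taylorJet (Qw cd) (toVec cd x) n c' * u ^ n + toVec cd J c' * u ^ (p + 1) < toVec cd hi c' := by
    intro u hu c'
    have h1 := htest u hu (modeOf cd c') (shellOf cd c') (shellOf_mem cd c').1 (shellOf_mem cd c').2
    have e1 : ∀ n, taylorJet (Qw cd) (toVec cd x) n c' = taylorJet cd.Qb x n (modeOf cd c') (shellOf cd c') := by
      intro n
      rw [← toVec_taylorJet]
      rfl
    simp only [e1]
    exact h1
  exact flowSel_of_highOrderEnclosure hMS hh hJ' htest'

/-- **(F1′a, high-order test)** The selector flow from `x` solves K1b-DR's ODE clause on `[0,h]`. [folklore] -/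
theorem solvesOn_liftFlowSel_of_hoTest
    (hMS : IsMajorantSystem (nW cd) (Qw cd) (wW cd j) (cd.bb j) (taylorJet (Qw cd)) (varJet (Qw cd)))
    (hh : 0 ≤ h)
    (hJ : ∀ y : Fin 4 → ℤ → ℝ, (∀ i k, -cd.Kb ≤ k → k ≤ cd.Ka → lo i k ≤ y i k ∧ y i k ≤ hi i k) →
      ∀ i k, -cd.Kb ≤ k → k ≤ cd.Ka → |taylorJet cd.Qb y (p + 1) i k| ≤ J i k)
    (htest : ∀ u ∈ Icc (0:ℝ) h, ∀ i k, -cd.Kb ≤ k → k ≤ cd.Ka →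
      lo i k < (∑ n ∈ Finset.range (p + 1), taylorJet cd.Qb x n i k * u ^ n) - J i k * u ^ (p + 1) ∧
      (∑ n ∈ Finset.range (p + 1), taylorJet cd.Qb x n i k * u ^ n) + J i k * u ^ (p + 1) < hi i k) :
    SolvesOn cd (fun _ => liftFlow cd (fun x s => flowSel (Qw cd) x s)) j x h := by
  have hsol := (flowSel_window_of_hoTest hMS hh hJ htest).1
  intro i k hk1 hk2
  have hk : -cd.Kb ≤ k ∧ k ≤ cd.Ka := ⟨hk1, hk2⟩
  refine ⟨liftFlowSel_zero x i hk, fun t' ht' => ?_⟩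
  set c : Fin (nW cd) := eW cd (i, ⟨k, Finset.mem_Icc.2 hk⟩) with hc
  have hcomp : HasDerivWithinAt (fun s => flowSel (Qw cd) (toVec cd x) s c)
      (Qw cd (flowSel (Qw cd) (toVec cd x) t') (flowSel (Qw cd) (toVec cd x) t') c) (Icc 0 h) t' :=
    (hasDerivWithinAt_pi.1 (hsol.2 t' ht')) c
  have hfun : (fun s => liftFlow cd (fun x s => flowSel (Qw cd) x s) x i k s) =
      fun s => flowSel (Qw cd) (toVec cd x) s c := by
    funext s; rw [liftFlow_of_mem x i hk]
  rw [show (fun _ => liftFlow cd (fun x s => flowSel (Qw cd) x s)) j x i k =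
      fun s => liftFlow cd (fun x s => flowSel (Qw cd) x s) x i k s from rfl, hfun]
  convert hcomp using 1
  rw [quadTerm_trunc_eq_qT (cd := cd) _ i hk, qT_eq_Qw_apply (cd := cd) _ i hk]
  congr 1 <;>
  · funext c'
    simp only [toVec]
    rw [liftFlow_of_mem _ _ (shellOf_mem cd c')]
    congr 1
    exact (Equiv.apply_symm_apply (eW cd) c')

/-- **(F1′b, high-order test)** The selector flow from `x` stays in the box on `[0,h]`. [folklore] -/
theorem window_bounds_liftFlowSel_of_hoTest
    (hMS : IsMajorantSystem (nW cd) (Qw cd) (wW cd j) (cd.bb j) (taylorJet (Qw cd)) (varJet (Qw cd)))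
    (hh : 0 ≤ h)
    (hJ : ∀ y : Fin 4 → ℤ → ℝ, (∀ i k, -cd.Kb ≤ k → k ≤ cd.Ka → lo i k ≤ y i k ∧ y i k ≤ hi i k) →
      ∀ i k, -cd.Kb ≤ k → k ≤ cd.Ka → |taylorJet cd.Qb y (p + 1) i k| ≤ J i k)
    (htest : ∀ u ∈ Icc (0:ℝ) h, ∀ i k, -cd.Kb ≤ k → k ≤ cd.Ka →
      lo i k < (∑ n ∈ Finset.range (p + 1), taylorJet cd.Qb x n i k * u ^ n) - J i k * u ^ (p + 1) ∧
      (∑ n ∈ Finset.range (p + 1), taylorJet cd.Qb x n i k * u ^ n) + J i k * u ^ (p + 1) < hi i k) :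
    ∀ u ∈ Icc 0 h, ∀ i k, -cd.Kb ≤ k → k ≤ cd.Ka →
      lo i k ≤ stAt (fun _ => liftFlow cd (fun x s => flowSel (Qw cd) x s)) j x u i k ∧
        stAt (fun _ => liftFlow cd (fun x s => flowSel (Qw cd) x s)) j x u i k ≤ hi i k := by
  intro u hu
  have hbox := (flowSel_window_of_hoTest hMS hh hJ htest).2.1 u hu
  rw [stAt_liftFlow]
  exact ofVec_window_bounds (cd := cd) hbox

/-- **(F5′, high-order test)** The componentwise Taylor remainder of the selector flow from `x`. [folklore] -/
theorem taylor_liftFlowSel_of_hoTest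
    (hMS : IsMajorantSystem (nW cd) (Qw cd) (wW cd j) (cd.bb j) (taylorJet (Qw cd)) (varJet (Qw cd)))
    (hh : 0 ≤ h)
    (hJ : ∀ y : Fin 4 → ℤ → ℝ, (∀ i k, -cd.Kb ≤ k → k ≤ cd.Ka → lo i k ≤ y i k ∧ y i k ≤ hi i k) →
      ∀ i k, -cd.Kb ≤ k → k ≤ cd.Ka → |taylorJet cd.Qb y (p + 1) i k| ≤ J i k)
    (htest : ∀ u ∈ Icc (0:ℝ) h, ∀ i k, -cd.Kb ≤ k → k ≤ cd.Ka →
      lo i k < (∑ n ∈ Finset.range (p + 1), taylorJet cd.Qb x n i k * u ^ n) - J i k * u ^ (p + 1) ∧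
      (∑ n ∈ Finset.range (p + 1), taylorJet cd.Qb x n i k * u ^ n) + J i k * u ^ (p + 1) < hi i k) :
    ∀ u ∈ Icc 0 h, ∀ i k, -cd.Kb ≤ k → k ≤ cd.Ka →
      |stAt (fun _ => liftFlow cd (fun x s => flowSel (Qw cd) x s)) j x u i k
        - ∑ n ∈ Finset.range (p + 1), taylorJet cd.Qb x n i k * u ^ n| ≤ J i k * u ^ (p + 1) := by
  intro u hu i k hk1 hk2
  have hk : -cd.Kb ≤ k ∧ k ≤ cd.Ka := ⟨hk1, hk2⟩
  set c : Fin (nW cd) := eW cd (i, ⟨k, Finset.mem_Icc.2 hk⟩) with hc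
  have key := (flowSel_window_of_hoTest hMS hh hJ htest).2.2 u hu c
  rw [stAt_liftFlow, ofVec_apply_of_mem cd _ i hk]
  have e1 : ∀ n, taylorJet (Qw cd) (toVec cd x) n c = taylorJet cd.Qb x n i k := by
    intro n
    rw [← toVec_taylorJet]
    simp [toVec, hc, modeOf, shellOf]
  have e2 : toVec cd J c = J i k := by simp [toVec, hc, modeOf, shellOf]
  simp only [e1, e2] at key
  exact key

end Summit.NavierStokesRegularity.NavierStokesRegularity.Theorems.TaylorModelReadout

end
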